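import Summits.ResolutionOfSingularities.ResolutionOfSingularities.Theorems.WallExit
import HarnessLib

/-!
# WallTowers — decomp-res node «WallCut» (lens-4 g30, critic rows 176/176a CLEARED DECIDED +1), tree file 6/8 of the node

Content VERBATIM from the decomp-res lens-4 g30 node `HOME/decomp-res-lens-4/g30/WallCut.lean` (pin c43ccc48;
imports the landed tree only, carries nothing);
HOME = run/shared/lean/pub/decomp-res; critic rows 176/176a CLEARED DECIDED +1; landing orders INBOX :819 —
provenance, critic text and the lens header in full in the first file of the
node, `WallAlgebra`.  Namespace `…Theorems.HugValuationCut`; `--supports stmt-ResolutionOfSingularities-28338`.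

## This file

§84 (NEW, KERNEL) THE WALL CLOCK AND WALL DEATH ALONG lens-4's `ForcedTower` — `section WallTowers`: `wallIter` /
`newWallIter` (iterated transported walls), the wall clock, `TwoWallStage`, `WalledTower`, THE LAW
**`twoWall_noSucc`** «WALL DEATH: at weight 2 = char 2 a two-wall stage of wall exponent `e` has no `e`-th
successor», `no_walledTower`, and the CLASS-GENERIC cut `noTowerWild_walled_holds` (cuts the weight-2 walled column
out of every class `P` with `P T → PPowerTower n T`).

[WRITER NOTE (decomp-res writer g11): file split only (tree files ≤ 400 lines); namespace, universes, sections,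
section variables and every declaration
exactly as in the lens (the node's global dupNamespace-linter line is dropped — the library sets it; the `open
…Theses` line lives only in the Theses-cone file;
`set_option maxHeartbeats … in` prefixes of single declarations are kept VERBATIM).  ONE deletion (gate dedup rule,
critic :835 watch-list): the node's private copy of
isUnit_add_of_mem_maximalIdeal` is NOT re-landed — it is LITERALLY the landed
`Literature.AlgebraicGeometry.Resolution.isUnit_add_of_mem_maximalIdeal` (`WeightedInitialTerms`,
imported; the namespace is opened as in the lens), which the transport proofs now cite by the same short name.
SECOND deletion (gate dedup bounce p810318):
the node's `range_triple` is NOT re-landed — it is LITERALLY the landed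
`…Cruxes.HypersurfaceCentreConstruction.LocalEngine.Iota3.range_vec₃`
(`Theorems/WeightedInvariantIota3FlagTools`, imported from `WallAlgebra2` on; aliased by an explicit `open …
(range_vec₃)`), cited by name at its two uses.]

(Sources: Hauser2010Kangaroo (arXiv:0811.4151, Kangaroo Theorem condition (3)); HauserPerlega2019 §2; Hauser2024
PRIMS 60; Moh1987; Perlega2023; Matsumura1987 Thms. 14.2–14.3, 19.x; ZariskiSamuel1960 VIII §11; StacksProject Tags
0804, 0BIQ, 00NQ, 0AGS; DeJong1996 2.4; CossartPiltant2008 §2; Giraud1975.)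
-/

noncomputable section

open CategoryTheory AlgebraicGeometry IsLocalRing
open Literature.AlgebraicGeometry.Resolution
open Summit.ResolutionOfSingularities.ResolutionOfSingularities.Theorems
open WeakOrderReduction ForcedTowerClasses DivergentTowerClasses MonomialTowerClasses
open HugDimensionClasses HugDimensionKernels SurfaceShadowClasses SurfaceShadowKernels
open NearPointCut (SingularClass)
open scoped BigOperators
open Summit.ResolutionOfSingularities.ResolutionOfSingularities.Cruxes.HypersurfaceCentreConstruction.LocalEngine.Iota3 (range_vec₃)

namespace Summit.ResolutionOfSingularities.ResolutionOfSingularities.Theorems.HugValuationCut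

section WallTowers

variable {k : Type} [Field k]

/-! ## §84 (g30 · NEW · KERNEL) THE WALL CLOCK AND WALL DEATH ALONG lens-4's `ForcedTower`: the wall exponent drops by one per
satellite step along the kept wall, a run of `e` such steps is impossible (`no_wallRunTower`), an early or lateral exit is
impossible (`no_wallExitTower`) — in every ring dimension —, and in ring dimension 3 the free exit is fatal: A TWO-WALL STAGE OF
EXPONENT `e` HAS NO `e`-TH SUCCESSOR (`twoWall_noSucc`, `no_walledTower`). -/

/-- **`wallIter T i W l` — the `l`-th iterated WEAK transform (weight 1) of an ideal sheaf `W` of stage `i` along the tower**,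
an ideal sheaf on stage `i + l` (`l = 0`: `W` itself).  Used for the kept wall AND for the contact germ.  DEFINITION
(support). -/
noncomputable def wallIter (T : ForcedTower) (i : ℕ) (W : (T.St i).IdealSheafData) : (l : ℕ) → (T.St (i + l)).IdealSheafData
  | 0 => W
  | l + 1 => controlledTransform (T.π (i + l)) (T.centre (i + l)) (wallIter T i W l) 1

/-- **`newWallIter T i V l` — the OTHER wall along a satellite run**: `V` at stage `i`, and at stage `i + l + 1` the exceptional
divisor `E_{i+l+1} = π_{i+l}^{-1}(x_{i+l})` just created.  DEFINITION (support). -/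
noncomputable def newWallIter (T : ForcedTower) (i : ℕ) (V : (T.St i).IdealSheafData) :
    (l : ℕ) → (T.St (i + l)).IdealSheafData
  | 0 => V
  | l + 1 => (T.centre (i + l)).comap (T.π (i + l))

/-- **THE WALL LAW, ONE STAGE OF THE TOWER (KERNEL, PROVED; weight 2, characteristic 2, ring dimension ≤ 3 at the successor).**
`TwoWallAt` at stage `i` with wall exponent `e` and the marked point `x_{i+1}` ON the weak transform of the kept
wall ⟹ `e ≥ 2` and
`TwoWallAt` at stage `i + 1` with wall exponent `e − 1` along the weak transforms of the kept wall and of the germ.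
(Sources: Hauser2010Kangaroo; Matsumura1987, Thms. 14.2–14.3; StacksProject, Tag 0BIQ.) -/
theorem twoWall_succ [CharP k 2] (T : ForcedTower) (g : T.St 0 ⟶ Spec (.of k)) (hB : IsBase (T.St 0) g)
    (hD : IsDatum 2 (T.D 0)) (hP : PPowerTower 2 T) (i : ℕ) (hdim : ¬ DimFourAt T (i + 1))
    (W V H : (T.St i).IdealSheafData) {e : ℕ} (h : TwoWallAt (T.D i).ideal W V H e (T.pt i))
    (hsat : T.pt (i + 1) ∈ ((controlledTransform (T.π i) (T.centre i) W 1).support : Set (T.St (i + 1)))) :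
    2 ≤ e ∧ TwoWallAt (T.D (i + 1)).ideal (controlledTransform (T.π i) (T.centre i) W 1)
      ((T.centre i).comap (T.π i)) (controlledTransform (T.π i) (T.centre i) H 1) (e - 1) (T.pt (i + 1)) := by
  obtain ⟨hNi, hRi⟩ := tower_isLocallyNoetherian_isRegular T g hB i
  obtain ⟨hNi1, -⟩ := tower_isLocallyNoetherian_isRegular T g hB (i + 1)
  haveI := hNi
  haveI := hNi1
  have hπ := T.isBlowup i
  have hy : (T.π i).base (T.pt (i + 1)) = T.pt i := T.pt_map i
  have hDi1 : (T.D (i + 1)).ideal = controlledTransform (T.π i) (T.centre i) (T.D i).ideal 2 := by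
    rw [T.transform_eq i, MarkedIdeal.transform_ideal, tower_mult_eq T hD i]
  rw [hDi1]
  have h0 : TwoWallAt (T.D i).ideal W V H e ((T.π i).base (T.pt (i + 1))) := by rw [hy]; exact h
  have hIn : stalkIdeal (T.D i).ideal ((T.π i).base (T.pt (i + 1))) ≤ maximalIdeal _ ^ 2 := by
    rw [hy]; exact tower_stalkIdeal_le_pow T hD i
  have hI'n : stalkIdeal (controlledTransform (T.π i) (T.centre i) (T.D i).ideal 2) (T.pt (i + 1)) ≤
      maximalIdeal _ ^ 2 := by
    have h1 := tower_stalkIdeal_le_pow T hD (i + 1)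
    rw [hDi1] at h1
    exact h1
  have hpt' : ((T.centre i).support : Set (T.St i)) = {(T.π i).base (T.pt (i + 1))} := by
    rw [hy]; exact T.centre_support i
  have hcl : IsClosed ({(T.π i).base (T.pt (i + 1))} : Set (T.St i)) := by rw [hy]; exact T.isClosed_pt i
  haveI : CharP ((T.St (i + 1)).presheaf.stalk (T.pt (i + 1))) 2 := charP_stalk_stage T g (i + 1)
  have hPP : PPowerFormAt 2 (controlledTransform (T.π i) (T.centre i) (T.D i).ideal 2) 2 (T.pt (i + 1)) := by
    have h1 := (pPowerTower_iff Nat.prime_two T g).mp hP (i + 1)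
    rw [hDi1] at h1
    exact h1
  have hdim' : ¬ (4 : WithBot ℕ∞) ≤ ringKrullDim ((T.St (i + 1)).presheaf.stalk (T.pt (i + 1))) := hdim
  exact twoWall_point_transport hπ hRi (T.centre_regular i) _ W V H _ hcl hpt' hIn hI'n hdim' hPP h0 hsat

/-- **THE WALL LAW ALONG A SATELLITE RUN (KERNEL, PROVED): THE WALL EXPONENT IS A CLOCK.**  `TwoWallAt` at stage `i` with wall
exponent `e`, and the marked points `x_{i+1}, …, x_{i+l}` all ON the successive weak transforms of the kept wall (a
SATELLITE RUN of
length `l` along the wall, ring dimension ≤ 3 along it) ⟹ `l + 1 ≤ e` and `TwoWallAt` at stage `i + l` with wall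
exponent `e − l`.
Structural recursion on the run. (Sources: Hauser2010Kangaroo; Matsumura1987, Thms. 14.2–14.3.) -/
theorem twoWall_run [CharP k 2] (T : ForcedTower) (g : T.St 0 ⟶ Spec (.of k)) (hB : IsBase (T.St 0) g)
    (hD : IsDatum 2 (T.D 0)) (hP : PPowerTower 2 T) (i : ℕ) (W V H : (T.St i).IdealSheafData) :
    ∀ l e : ℕ, TwoWallAt (T.D i).ideal W V H e (T.pt i) →
      (∀ j < l, ¬ DimFourAt T (i + j + 1) ∧
        T.pt (i + j + 1) ∈ ((wallIter T i W (j + 1)).support : Set (T.St (i + j + 1)))) →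
      l + 1 ≤ e ∧
        TwoWallAt (T.D (i + l)).ideal (wallIter T i W l) (newWallIter T i V l) (wallIter T i H l) (e - l) (T.pt (i + l))
  | 0, e, h, _ => by
    obtain ⟨w, v, z, hWw, hVv, hHz, hrs, hfull, f, hfI, c, g', hc, hft, u, a, b, hu, ha, he, hg⟩ := h
    exact ⟨by omega, w, v, z, hWw, hVv, hHz, hrs, hfull, f, hfI, c, g', hc, hft, u, a, b, hu, ha, he, hg⟩
  | l + 1, e, h, hrun => by
    obtain ⟨hle, hl⟩ := twoWall_run T g hB hD hP i W V H l e h (fun j hj => hrun j (by omega))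
    obtain ⟨hdim, hsat⟩ := hrun l (by omega)
    obtain ⟨h2, hsucc⟩ :=
      twoWall_succ T g hB hD hP (i + l) hdim (wallIter T i W l) (newWallIter T i V l) (wallIter T i H l) hl hsat
    refine ⟨by omega, ?_⟩
    have e1 : e - l - 1 = e - (l + 1) := by omega
    rw [e1] at hsucc
    exact hsucc

/-- **THE EXIT LAW, ONE STAGE OF THE TOWER (KERNEL, PROVED; weight 2, characteristic 2, EVERY ring dimension).** `TwoWallAt` at
stage `i` with wall exponent `e` and the marked point `x_{i+1}` OFF the weak transform of the kept wall ⟹ `e = 1`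
and `x_{i+1}` is
OFF the weak transform of the other wall too. (Sources: Hauser2010Kangaroo; Matsumura1987, Thms. 14.2–14.3.) -/
theorem twoWall_exit_succ [CharP k 2] (T : ForcedTower) (g : T.St 0 ⟶ Spec (.of k)) (hB : IsBase (T.St 0) g)
    (hD : IsDatum 2 (T.D 0)) (hP : PPowerTower 2 T) (i : ℕ)
    (W V H : (T.St i).IdealSheafData) {e : ℕ} (h : TwoWallAt (T.D i).ideal W V H e (T.pt i))
    (hfree : T.pt (i + 1) ∉ ((controlledTransform (T.π i) (T.centre i) W 1).support : Set (T.St (i + 1)))) :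
    e = 1 ∧ T.pt (i + 1) ∉ ((controlledTransform (T.π i) (T.centre i) V 1).support : Set (T.St (i + 1))) := by
  obtain ⟨hNi, hRi⟩ := tower_isLocallyNoetherian_isRegular T g hB i
  obtain ⟨hNi1, -⟩ := tower_isLocallyNoetherian_isRegular T g hB (i + 1)
  haveI := hNi
  haveI := hNi1
  have hπ := T.isBlowup i
  have hy : (T.π i).base (T.pt (i + 1)) = T.pt i := T.pt_map i
  have hDi1 : (T.D (i + 1)).ideal = controlledTransform (T.π i) (T.centre i) (T.D i).ideal 2 := by
    rw [T.transform_eq i, MarkedIdeal.transform_ideal, tower_mult_eq T hD i]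
  have h0 : TwoWallAt (T.D i).ideal W V H e ((T.π i).base (T.pt (i + 1))) := by rw [hy]; exact h
  have hIn : stalkIdeal (T.D i).ideal ((T.π i).base (T.pt (i + 1))) ≤ maximalIdeal _ ^ 2 := by
    rw [hy]; exact tower_stalkIdeal_le_pow T hD i
  have hI'n : stalkIdeal (controlledTransform (T.π i) (T.centre i) (T.D i).ideal 2) (T.pt (i + 1)) ≤
      maximalIdeal _ ^ 2 := by
    have h1 := tower_stalkIdeal_le_pow T hD (i + 1)
    rw [hDi1] at h1
    exact h1
  have hpt' : ((T.centre i).support : Set (T.St i)) = {(T.π i).base (T.pt (i + 1))} := by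
    rw [hy]; exact T.centre_support i
  have hcl : IsClosed ({(T.π i).base (T.pt (i + 1))} : Set (T.St i)) := by rw [hy]; exact T.isClosed_pt i
  haveI : CharP ((T.St (i + 1)).presheaf.stalk (T.pt (i + 1))) 2 := charP_stalk_stage T g (i + 1)
  have hPP : PPowerFormAt 2 (controlledTransform (T.π i) (T.centre i) (T.D i).ideal 2) 2 (T.pt (i + 1)) := by
    have h1 := (pPowerTower_iff Nat.prime_two T g).mp hP (i + 1)
    rw [hDi1] at h1
    exact h1
  exact twoWall_point_exit hπ hRi (T.centre_regular i) _ W V H _ hcl hpt' hIn hI'n hPP h0 hfree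

/-- **THE WALL CLOCK, ONE STAGE OF THE TOWER (KERNEL, PROVED; weight 2 = characteristic, ring dimension ≤ 3 at the
successor): THE
DICHOTOMY.**  From a two-wall stage `i` of wall exponent `e`: EITHER `x_{i+1}` lies on the kept wall, `e ≥ 2`, and
stage `i + 1` is
a two-wall stage of exponent `e − 1` with the newest exceptional divisor as the other wall (THE CLOCK TICKS), OR `e = 1` and
`x_{i+1}` lies on NEITHER wall (THE CLOCK HAS RUN OUT: a free move).  [folklore] -/
theorem twoWall_dichotomy_succ [CharP k 2] (T : ForcedTower) (g : T.St 0 ⟶ Spec (.of k)) (hB : IsBase (T.St 0) g)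
    (hD : IsDatum 2 (T.D 0)) (hP : PPowerTower 2 T) (i : ℕ) (hdim : ¬ DimFourAt T (i + 1))
    (W V H : (T.St i).IdealSheafData) {e : ℕ} (h : TwoWallAt (T.D i).ideal W V H e (T.pt i)) :
    (T.pt (i + 1) ∈ ((controlledTransform (T.π i) (T.centre i) W 1).support : Set (T.St (i + 1))) ∧ 2 ≤ e ∧
        TwoWallAt (T.D (i + 1)).ideal (controlledTransform (T.π i) (T.centre i) W 1) ((T.centre i).comap (T.π i))
          (controlledTransform (T.π i) (T.centre i) H 1) (e - 1) (T.pt (i + 1))) ∨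
      (e = 1 ∧ T.pt (i + 1) ∉ ((controlledTransform (T.π i) (T.centre i) W 1).support : Set (T.St (i + 1))) ∧
        T.pt (i + 1) ∉ ((controlledTransform (T.π i) (T.centre i) V 1).support : Set (T.St (i + 1)))) := by
  by_cases hsat : T.pt (i + 1) ∈ ((controlledTransform (T.π i) (T.centre i) W 1).support : Set (T.St (i + 1)))
  · exact Or.inl ⟨hsat, twoWall_succ T g hB hD hP i hdim W V H h hsat⟩
  · obtain ⟨h1, h2⟩ := twoWall_exit_succ T g hB hD hP i W V H h hsat
    exact Or.inr ⟨h1, hsat, h2⟩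

/-- **`WallRunTower T` — THE TYPED SUB-CELL (NEW, load-bearing): A TWO-WALL STAGE FOLLOWED BY A SATELLITE RUN ALONG
ITS KEPT WALL
OF LENGTH AT LEAST THE WALL EXPONENT** — some stage `i`, wall `W`, germ `H` and exponent `e` with `TwoWallAt (𝓘_i) W
H e x_i`, and the
next `e` marked points `x_{i+1}, …, x_{i+e}` each ON the weak transform of the kept wall (and in ring dimension ≤ 3).  An
INFINITE satellite run along the wall is the special case «for every `j`».  DEFINITION (support). -/
def WallRunTower (T : ForcedTower) : Prop :=
  ∃ (i e : ℕ) (W V H : (T.St i).IdealSheafData), TwoWallAt (T.D i).ideal W V H e (T.pt i) ∧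
    ∀ j < e, ¬ DimFourAt T (i + j + 1) ∧ T.pt (i + j + 1) ∈ ((wallIter T i W (j + 1)).support : Set (T.St (i + j + 1)))

/-- an INFINITE satellite run along the kept wall of a two-wall stage is a wall run (special case). [folklore] -/
theorem wallRunTower_of_infinite_run {T : ForcedTower} {i e : ℕ} {W V H : (T.St i).IdealSheafData}
    (h : TwoWallAt (T.D i).ideal W V H e (T.pt i))
    (hrun : ∀ j, ¬ DimFourAt T (i + j + 1) ∧ T.pt (i + j + 1) ∈ ((wallIter T i W (j + 1)).support : Set (T.St (i + j + 1)))) :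
    WallRunTower T :=
  ⟨i, e, W, V, H, h, fun j _ => hrun j⟩

/-- **THE FINITENESS LAW BY NAME (KERNEL, PROVED, weight 2 = characteristic, every field of characteristic 2):
SATELLITE RUNS ALONG
THE KEPT WALL OF A TWO-WALL STAGE TERMINATE — their length is at most the wall exponent minus one; NO weight-2 `2`-power forced
tower is a `WallRunTower`.** [folklore] -/
theorem no_wallRunTower [CharP k 2] (T : ForcedTower) (g : T.St 0 ⟶ Spec (.of k)) (hB : IsBase (T.St 0) g)
    (hD : IsDatum 2 (T.D 0)) (hP : PPowerTower 2 T) : ¬ WallRunTower T := by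
  rintro ⟨i, e, W, V, H, h, hrun⟩
  have h1 := (twoWall_run T g hB hD hP i W V H e e h hrun).1
  omega

/-- the quantitative form: a satellite run of length `l` along the kept wall of a two-wall stage of exponent `e` has
`l ≤ e − 1`.
[folklore] -/
theorem wallRun_length_le [CharP k 2] (T : ForcedTower) (g : T.St 0 ⟶ Spec (.of k)) (hB : IsBase (T.St 0) g)
    (hD : IsDatum 2 (T.D 0)) (hP : PPowerTower 2 T) {i e l : ℕ} {W V H : (T.St i).IdealSheafData}
    (h : TwoWallAt (T.D i).ideal W V H e (T.pt i))
    (hrun : ∀ j < l, ¬ DimFourAt T (i + j + 1) ∧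
      T.pt (i + j + 1) ∈ ((wallIter T i W (j + 1)).support : Set (T.St (i + j + 1)))) : l ≤ e - 1 := by
  have h1 := (twoWall_run T g hB hD hP i W V H l e h hrun).1
  omega

/-- **`WallExitTower T` — THE SECOND TYPED SUB-CELL (NEW): A TWO-WALL STAGE LEFT OFF THE CLOCK** — some two-wall
stage `i` of wall
exponent `e` whose successor `x_{i+1}` is OFF the weak transform of the kept wall although `e ≥ 2` (EARLY exit), or is off the
kept wall and ON the weak transform of the other wall (LATERAL exit).  DEFINITION (support). -/
def WallExitTower (T : ForcedTower) : Prop :=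
  ∃ (i e : ℕ) (W V H : (T.St i).IdealSheafData), TwoWallAt (T.D i).ideal W V H e (T.pt i) ∧
    T.pt (i + 1) ∉ ((controlledTransform (T.π i) (T.centre i) W 1).support : Set (T.St (i + 1))) ∧
      (2 ≤ e ∨ T.pt (i + 1) ∈ ((controlledTransform (T.π i) (T.centre i) V 1).support : Set (T.St (i + 1))))

/-- **KERNEL (PROVED, every field of characteristic 2, EVERY ring dimension): NO weight-2 `2`-power forced tower
leaves a two-wall
stage off the clock.** [folklore] -/
theorem no_wallExitTower [CharP k 2] (T : ForcedTower) (g : T.St 0 ⟶ Spec (.of k)) (hB : IsBase (T.St 0) g)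
    (hD : IsDatum 2 (T.D 0)) (hP : PPowerTower 2 T) : ¬ WallExitTower T := by
  rintro ⟨i, e, W, V, H, h, hfree, hor⟩
  obtain ⟨h1, h2⟩ := twoWall_exit_succ T g hB hD hP i W V H h hfree
  rcases hor with h3 | h3
  · omega
  · exact h2 h3

/-- **`OffClockTower T` — THE DECIDED SUB-CELL OF THIS NODE: THE TOWER VIOLATES THE WALL CLOCK at some two-wall
stage** — it stays
on the kept wall for at least `e` further steps (`WallRunTower`), or it leaves the kept wall early or laterally
(`WallExitTower`).
DEFINITION (support). -/
def OffClockTower (T : ForcedTower) : Prop :=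
  WallRunTower T ∨ WallExitTower T

/-- **THE WALL CLOCK BY NAME (KERNEL, PROVED, weight 2 = characteristic, every field of characteristic 2): no weight-2 `2`-power
forced tower violates the wall clock.** [folklore] -/
theorem no_offClockTower [CharP k 2] (T : ForcedTower) (g : T.St 0 ⟶ Spec (.of k)) (hB : IsBase (T.St 0) g)
    (hD : IsDatum 2 (T.D 0)) (hP : PPowerTower 2 T) : ¬ OffClockTower T := by
  rintro (h | h)
  · exact no_wallRunTower T g hB hD hP h
  · exact no_wallExitTower T g hB hD hP h

/-- **THE FATAL EXIT, ONE STAGE OF THE TOWER (KERNEL, PROVED; weight 2 = characteristic, ring dimension ≥ 3 at the successor).**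
`TwoWallAt` at stage `i` and the marked point `x_{i+1}` OFF the weak transform of the kept wall ⟹ ABSURD
(`twoWall_point_fatal`).
(Sources: Hauser2010Kangaroo; Matsumura1987, Thm. 14.2; StacksProject, Tags 052P, 0BIQ.) -/
theorem twoWall_fatal_succ [CharP k 2] (T : ForcedTower) (g : T.St 0 ⟶ Spec (.of k)) (hB : IsBase (T.St 0) g)
    (hD : IsDatum 2 (T.D 0)) (hP : PPowerTower 2 T) (i : ℕ) (hdim3 : DimThreeAt T (i + 1))
    (W V H : (T.St i).IdealSheafData) {e : ℕ} (h : TwoWallAt (T.D i).ideal W V H e (T.pt i))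
    (hfree : T.pt (i + 1) ∉ ((controlledTransform (T.π i) (T.centre i) W 1).support : Set (T.St (i + 1)))) : False := by
  obtain ⟨hNi, hRi⟩ := tower_isLocallyNoetherian_isRegular T g hB i
  obtain ⟨hNi1, hRi1⟩ := tower_isLocallyNoetherian_isRegular T g hB (i + 1)
  haveI := hNi
  haveI := hNi1
  have hπ := T.isBlowup i
  have hy : (T.π i).base (T.pt (i + 1)) = T.pt i := T.pt_map i
  have hDi1 : (T.D (i + 1)).ideal = controlledTransform (T.π i) (T.centre i) (T.D i).ideal 2 := by
    rw [T.transform_eq i, MarkedIdeal.transform_ideal, tower_mult_eq T hD i]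
  have h0 : TwoWallAt (T.D i).ideal W V H e ((T.π i).base (T.pt (i + 1))) := by rw [hy]; exact h
  have hIn : stalkIdeal (T.D i).ideal ((T.π i).base (T.pt (i + 1))) ≤ maximalIdeal _ ^ 2 := by
    rw [hy]; exact tower_stalkIdeal_le_pow T hD i
  have hI'n : stalkIdeal (controlledTransform (T.π i) (T.centre i) (T.D i).ideal 2) (T.pt (i + 1)) ≤
      maximalIdeal _ ^ 2 := by
    have h1 := tower_stalkIdeal_le_pow T hD (i + 1)
    rw [hDi1] at h1
    exact h1
  have hpt' : ((T.centre i).support : Set (T.St i)) = {(T.π i).base (T.pt (i + 1))} := by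
    rw [hy]; exact T.centre_support i
  have hcl : IsClosed ({(T.π i).base (T.pt (i + 1))} : Set (T.St i)) := by rw [hy]; exact T.isClosed_pt i
  haveI : CharP ((T.St (i + 1)).presheaf.stalk (T.pt (i + 1))) 2 := charP_stalk_stage T g (i + 1)
  have hPP : PPowerFormAt 2 (controlledTransform (T.π i) (T.centre i) (T.D i).ideal 2) 2 (T.pt (i + 1)) := by
    have h1 := (pPowerTower_iff Nat.prime_two T g).mp hP (i + 1)
    rw [hDi1] at h1
    exact h1
  have hdim3' : (3 : WithBot ℕ∞) ≤ ringKrullDim ((T.St (i + 1)).presheaf.stalk (T.pt (i + 1))) := hdim3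
  exact twoWall_point_fatal hπ hRi hRi1 (T.centre_regular i) _ W V H _ hcl hpt' hIn hI'n hdim3' hPP h0 hfree

/-- **WALL DEATH (KERNEL, PROVED; weight 2 = characteristic, every field of characteristic 2): A TWO-WALL STAGE OF WALL EXPONENT
`e` HAS NO `e`-TH SUCCESSOR** in ring dimension 3: from `TwoWallAt` at stage `i` with exponent `e`, if the stages `i+1, …, i+e`
have ring dimension exactly `3` at their marked points, the tower does not exist — the clock ticks `e ↦ e − 1` while the marked
point stays on the kept wall (`twoWall_succ`), it cannot leave the wall while `e ≥ 2` nor laterally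
(`twoWall_exit_succ`), and the
free exit at `e = 1` is fatal (`twoWall_fatal_succ`).  Structural induction on `e`. (Sources: Hauser2010Kangaroo;
Matsumura1987.) -/
theorem twoWall_noSucc [CharP k 2] (T : ForcedTower) (g : T.St 0 ⟶ Spec (.of k)) (hB : IsBase (T.St 0) g)
    (hD : IsDatum 2 (T.D 0)) (hP : PPowerTower 2 T) :
    ∀ (e i : ℕ) (W V H : (T.St i).IdealSheafData), TwoWallAt (T.D i).ideal W V H e (T.pt i) →
      (∀ j < e, DimThreeAt T (i + j + 1) ∧ ¬ DimFourAt T (i + j + 1)) → False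
  | 0, i, W, V, H, h, _ => by
    obtain ⟨w, v, z, -, -, -, -, -, f, -, c, g', -, -, u, a, b, -, -, he, -⟩ := h
    omega
  | e + 1, i, W, V, H, h, hdim => by
    rcases twoWall_dichotomy_succ T g hB hD hP i (hdim 0 (by omega)).2 W V H h with ⟨-, -, hsucc⟩ | ⟨-, hfree, -⟩
    · have e1 : e + 1 - 1 = e := by omega
      rw [e1] at hsucc
      refine twoWall_noSucc T g hB hD hP e (i + 1) _ _ _ hsucc fun j hj => ?_
      obtain ⟨h3, h4⟩ := hdim (j + 1) (by omega)
      have e2 : i + (j + 1) + 1 = i + 1 + j + 1 := by omega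
      rw [e2] at h3 h4
      exact ⟨h3, h4⟩
    · exact twoWall_fatal_succ T g hB hD hP i (hdim 0 (by omega)).1 W V H h hfree

/-- **`WalledTower T` — THE DECIDED TYPED SUB-CELL OF THIS NODE (NEW, load-bearing): THE TOWER PASSES THROUGH A
WALL** — some stage
`i` is a two-wall stage `TwoWallAt (𝓘_i) W V H e x_i` of wall exponent `e`, and the next `e` stages have ring
dimension exactly `3`
at their marked points (the letters `DimThreeAt ∧ ¬ DimFourAt`, automatic over a threefold base).  DEFINITION (support). -/
def WalledTower (T : ForcedTower) : Prop :=
  ∃ (i e : ℕ) (W V H : (T.St i).IdealSheafData), TwoWallAt (T.D i).ideal W V H e (T.pt i) ∧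
    ∀ j < e, DimThreeAt T (i + j + 1) ∧ ¬ DimFourAt T (i + j + 1)

/-- **THE FINITENESS LAW BY NAME (KERNEL, PROVED, weight 2 = characteristic, every field of characteristic 2): NO weight-2
`2`-power forced tower is walled — after a two-wall stage of wall exponent `e` there are at most `e − 1` further
marked points.**
[folklore] -/
theorem no_walledTower [CharP k 2] (T : ForcedTower) (g : T.St 0 ⟶ Spec (.of k)) (hB : IsBase (T.St 0) g)
    (hD : IsDatum 2 (T.D 0)) (hP : PPowerTower 2 T) : ¬ WalledTower T := by
  rintro ⟨i, e, W, V, H, h, hdim⟩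
  exact twoWall_noSucc T g hB hD hP e i W V H h hdim

/-- a wall run of full length in ring dimension exactly 3 is walled (the off-clock cells of the exit law are
sub-cells). [folklore] -/
theorem walledTower_of_run {T : ForcedTower} {i e : ℕ} {W V H : (T.St i).IdealSheafData}
    (h : TwoWallAt (T.D i).ideal W V H e (T.pt i)) (hdim : ∀ j < e, DimThreeAt T (i + j + 1) ∧ ¬ DimFourAt T (i + j + 1)) :
    WalledTower T :=
  ⟨i, e, W, V, H, h, hdim⟩

end WallTowers

end Summit.ResolutionOfSingularities.ResolutionOfSingularities.Theorems.HugValuationCut
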